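import Literature.Analysis.InverseSpectral.KreinString
import Literature.Analysis.FunctionSpaces.HellySelectionProofs
import HarnessLib

/-!
# Compactness of the space of strings (Helly selection for mass profiles)

A Kreĭn string `S[m, L]` is encoded by its **profile** `u ↦ arctan m(u/(1-u))` on `[0, 1]`
(value `π/2` beyond the right end `L`), a monotone function with values in `[0, π/2]`
(`KreinString.profile`, `monotoneOn_profile`). Helly's selection lemma
(`Literature.Analysis.FunctionSpaces.helly_selection_monotoneOn_holds`) then extracts from every
sequence of strings a subsequence whose profiles converge at every point (`exists_subseq_profile`);
unwinding the encoding, along the subsequence the mass functions converge wherever the limit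
profile is `< π/2`, and explode (or the strings end) wherever it equals `π/2`
(`exists_subseq_mass_tendsto`). This is the compactness half of the approximation proof of the
existence part of Kreĭn's inverse spectral theorem (Kac–Kreĭn 1974 §11; Kotani–Watanabe 1982 §2:
the space `𝓜` of strings is compact).

## References

KacKrein1974 (§11), KotaniWatanabe1982 (§2), Carothers2000 (Lemma 13.15).
-/

open MeasureTheory Filter Set Topology
open scoped ENNReal

noncomputable section

namespace Literature.Analysis.InverseSpectral

namespace KreinString

open Classical in
/-- The **profile** of a string: `u ↦ arctan m(u/(1-u))` for `u < 1` with `u/(1-u)` inside the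
string, `π/2` otherwise. [cite: KotaniWatanabe1982, §2] -/
def profile (S : KreinString) (u : ℝ) : ℝ :=
  if u < 1 ∧ u / (1 - u) ∈ S.dom then Real.arctan (S.mass (u / (1 - u))) else Real.pi / 2

/-- `profile ≤ π/2`. [folklore] -/
lemma profile_le (S : KreinString) (u : ℝ) : S.profile u ≤ Real.pi / 2 := by
  unfold profile
  split_ifs
  · exact (Real.arctan_lt_pi_div_two _).le
  · exact le_rfl

/-- `0 ≤ profile`. [folklore] -/
lemma profile_nonneg (S : KreinString) (u : ℝ) : 0 ≤ S.profile u := by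
  unfold profile
  split_ifs
  · rw [← Real.arctan_zero]
    exact Real.arctan_strictMono.monotone (S.mass_nonneg _)
  · positivity

/-- `|profile| ≤ π/2`. [folklore] -/
lemma abs_profile_le (S : KreinString) (u : ℝ) : |S.profile u| ≤ Real.pi / 2 := by
  rw [abs_of_nonneg (S.profile_nonneg u)]
  exact S.profile_le u

/-- `u ↦ u/(1-u)` is increasing on `[0, 1)`. [folklore] -/
lemma div_one_sub_mono {u v : ℝ} (huv : u ≤ v) (hv : v < 1) :
    u / (1 - u) ≤ v / (1 - v) := by
  rw [div_le_div_iff₀ (by linarith) (by linarith)]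
  nlinarith

/-- The points of the string form an initial segment (local copy). [folklore] -/
private lemma mem_dom_of_le' (S : KreinString) {x y : ℝ} (hx : 0 ≤ x) (hxy : x ≤ y) (hy : y ∈ S.dom) :
    x ∈ S.dom :=
  ⟨hx, lt_of_le_of_lt (ENNReal.ofReal_le_ofReal hxy) hy.2⟩

/-- **The profile is monotone on `[0, 1]`.** [cite: KotaniWatanabe1982, §2] -/
theorem monotoneOn_profile (S : KreinString) : MonotoneOn S.profile (Icc 0 1) := by
  intro u hu v hv huv
  by_cases hcv : v < 1 ∧ v / (1 - v) ∈ S.dom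
  · have hu1 : u < 1 := lt_of_le_of_lt huv hcv.1
    have hle : u / (1 - u) ≤ v / (1 - v) := div_one_sub_mono huv hcv.1
    have hcu : u < 1 ∧ u / (1 - u) ∈ S.dom :=
      ⟨hu1, S.mem_dom_of_le' (div_nonneg hu.1 (by linarith)) hle hcv.2⟩
    unfold profile
    rw [if_pos hcu, if_pos hcv]
    exact Real.arctan_strictMono.monotone (S.monotoneOn_mass hcu.2 hcv.2 hle)
  · unfold profile
    rw [if_neg hcv]
    split_ifs
    · exact (Real.arctan_lt_pi_div_two _).le
    · exact le_rfl

/-- The profile at `u = x/(1+x)` reads off `arctan m(x)`. [folklore] -/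
lemma profile_of_mem_dom (S : KreinString) {x : ℝ} (hx : x ∈ S.dom) :
    S.profile (x / (1 + x)) = Real.arctan (S.mass x) := by
  have hx0 : 0 ≤ x := hx.1
  have h1 : x / (1 + x) < 1 := by rw [div_lt_one (by linarith)]; linarith
  have h2 : x / (1 + x) / (1 - x / (1 + x)) = x := by
    field_simp
    ring_nf
  unfold profile
  rw [h2, if_pos ⟨h1, hx⟩]

/-- Outside the string the profile is `π/2`. [folklore] -/
lemma profile_of_not_mem_dom (S : KreinString) {x : ℝ} (hx0 : 0 ≤ x) (hx : x ∉ S.dom) :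
    S.profile (x / (1 + x)) = Real.pi / 2 := by
  have h2 : x / (1 + x) / (1 - x / (1 + x)) = x := by
    field_simp
    ring_nf
  unfold profile
  rw [h2, if_neg (fun h => hx h.2)]

end KreinString

/-- **Helly selection for strings**: every sequence of strings has a subsequence whose profiles
converge at every point of `[0, 1]` to a monotone function with values in `[0, π/2]`.
[cite: KotaniWatanabe1982, §2] -/
theorem exists_subseq_profile (T : ℕ → KreinString) :
    ∃ φ : ℕ → ℕ, StrictMono φ ∧ ∃ G : ℝ → ℝ, MonotoneOn G (Icc 0 1) ∧
      (∀ u ∈ Icc (0 : ℝ) 1, |G u| ≤ Real.pi / 2) ∧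
      ∀ u ∈ Icc (0 : ℝ) 1, Tendsto (fun k => (T (φ k)).profile u) atTop (𝓝 (G u)) :=
  Literature.Analysis.FunctionSpaces.helly_selection_monotoneOn_holds 0 1 (Real.pi / 2)
    (fun n => (T n).profile) (fun n => (T n).monotoneOn_profile)
    (fun n u _ => (T n).abs_profile_le u)

/-- **Compactness of the space of strings** (mass-function form): along a subsequence, at every
`x ≥ 0` either the masses `m_{φ k}(x)` converge (to `tan G(x/(1+x))`, the limit profile being
`< π/2` there), or they explode / the strings end before `x` (limit profile `= π/2`); the set of
`x` of the first kind is an initial segment of `[0, ∞)`. [cite: KotaniWatanabe1982, §2] -/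
theorem exists_subseq_mass_tendsto (T : ℕ → KreinString) :
    ∃ φ : ℕ → ℕ, StrictMono φ ∧ ∃ G : ℝ → ℝ, MonotoneOn G (Icc 0 1) ∧
      (∀ u ∈ Icc (0 : ℝ) 1, 0 ≤ G u ∧ G u ≤ Real.pi / 2) ∧
      (∀ x : ℝ, 0 ≤ x → G (x / (1 + x)) < Real.pi / 2 →
        (∀ᶠ k in atTop, x ∈ (T (φ k)).dom) ∧
          Tendsto (fun k => (T (φ k)).mass x) atTop (𝓝 (Real.tan (G (x / (1 + x)))))) ∧
      (∀ x : ℝ, 0 ≤ x → G (x / (1 + x)) = Real.pi / 2 →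
        ∀ K : ℝ, ∀ᶠ k in atTop, x ∉ (T (φ k)).dom ∨ K ≤ (T (φ k)).mass x) := by
  obtain ⟨φ, hφ, G, hGm, hGb, hGt⟩ := exists_subseq_profile T
  have hux : ∀ x : ℝ, 0 ≤ x → x / (1 + x) ∈ Icc (0 : ℝ) 1 := fun x hx =>
    ⟨div_nonneg hx (by linarith), (div_le_one (by linarith)).2 (by linarith)⟩
  have hG0 : ∀ u ∈ Icc (0 : ℝ) 1, 0 ≤ G u := fun u hu =>
    ge_of_tendsto' (hGt u hu) (fun k => (T (φ k)).profile_nonneg u)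
  refine ⟨φ, hφ, G, hGm, fun u hu => ⟨hG0 u hu, (abs_le.1 (hGb u hu)).2⟩, ?_, ?_⟩
  · intro x hx hlt
    have ht := hGt _ (hux x hx)
    -- eventually the profile is `< π/2`, so `x` lies in the string and `arctan m → G`
    have hev : ∀ᶠ k in atTop, x ∈ (T (φ k)).dom := by
      have h1 : ∀ᶠ k in atTop, (T (φ k)).profile (x / (1 + x)) < Real.pi / 2 :=
        ht.eventually (Iio_mem_nhds hlt)
      filter_upwards [h1] with k hk
      by_contra hnd
      rw [(T (φ k)).profile_of_not_mem_dom hx hnd] at hk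
      exact lt_irrefl _ hk
    refine ⟨hev, ?_⟩
    have h2 : Tendsto (fun k => Real.arctan ((T (φ k)).mass x)) atTop (𝓝 (G (x / (1 + x)))) := by
      refine ht.congr' ?_
      filter_upwards [hev] with k hk
      exact (T (φ k)).profile_of_mem_dom hk
    have h3 : Tendsto (fun k => Real.tan (Real.arctan ((T (φ k)).mass x))) atTop
        (𝓝 (Real.tan (G (x / (1 + x))))) := by
      refine ((Real.continuousOn_tan_Ioo.continuousAt ?_).tendsto).comp h2
      refine Ioo_mem_nhds ?_ hlt
      linarith [hG0 _ (hux x hx), Real.pi_pos]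
    simpa [Real.tan_arctan] using h3
  · intro x hx heq K
    have ht := hGt _ (hux x hx)
    rw [heq] at ht
    have h1 : ∀ᶠ k in atTop, Real.arctan K < (T (φ k)).profile (x / (1 + x)) :=
      ht.eventually (Ioi_mem_nhds (Real.arctan_lt_pi_div_two K))
    filter_upwards [h1] with k hk
    by_cases hd : x ∈ (T (φ k)).dom
    · right
      rw [(T (φ k)).profile_of_mem_dom hd] at hk
      exact (Real.arctan_strictMono.lt_iff_lt.1 hk).le
    · exact Or.inl hd


end Literature.Analysis.InverseSpectral

end
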